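import Literature.Probability.LatticeModels.VillainTorusLongRangeOrder
import Literature.Probability.LatticeModels.VillainTorusWormRepresentation
import HarnessLib

/-!
# Block long-range order of the isotropic Villain current model on `(ℤ/Lℤ)³ × ℤ/Mℤ`, uniformly in `L, M`

Corollary of the Villain-rotator long-range order on the torus
(`villain_torus_pairExpect_cosDiff_ge`, Garban–Spencer 2022 run on the torus) and the worm
representation (`JCurrent.pairExpect_cosDiff_villain_eq_twoPoint`): for the isotropic Villain
integer-current model `PositiveCurrentModel.villain (fun _ => β)` on the space-time torus
`(ℤ/Lℤ)³ × ℤ/Mℤ` (Wallin et al. 1994 §II) there are `K₀, c > 0` such that for ALL `L, M ≥ 1` and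
`β ≥ K₀`,

  `c · L⁶ ≤ ∑_{x,y ∈ (ℤ/L)³} G_{L,M}(x, y)`   (`villain_current_twoPoint_blockSum_ge`),

the equal-time block long-range order of the worm two-point function, uniformly in the temporal
size `M` and the temporal stiffness being equal to the spatial one (`c = 1/(2·8⁶)`). The `M = 1`,
`ℝ≥0∞`-valued case is item `HomogeneousVillainLRO` of route
`AtomisticToContinuum/BoseEinsteinCondensation/BECVortexSheetPeierls`.

Theorems only.

## References

* C. Garban, T. Spencer, arXiv:2109.01617, Theorem 1.3 with Remarks 1 and 10. [GarbanSpencer2022]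
* M. Wallin, E. Sørensen, S. Girvin, A. P. Young, Phys. Rev. B 49 (1994) 12115, §II. [WallinEtAl1994]
-/

noncomputable section

namespace Literature.Probability.LatticeModels

open MeasureTheory Finset JCurrent PositiveCurrentModel
open scoped BigOperators

/-- **Block long-range order of the isotropic Villain current model, uniformly in `L` and `M`.**
There are `K₀, c > 0` such that for all `L, M ≥ 1`, `β ≥ K₀` (`β > 0`),
`c L⁶ ≤ ∑_{x,y} G_{L,M}(x,y)` for `PositiveCurrentModel.villain (fun _ : Dir 3 => β)`.
[cite: GarbanSpencer2022, Theorem 1.3 with Remark 1 and Remark 10] -/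
theorem villain_current_twoPoint_blockSum_ge :
    ∃ K₀ c : ℝ, 0 < c ∧ ∀ (L M : ℕ) [NeZero L] [NeZero M] (β : ℝ) (hβ : 0 < β), K₀ ≤ β →
      c * (L : ℝ) ^ 6 ≤ ∑ x : TorusSite 3 L, ∑ y : TorusSite 3 L,
        (villain (fun _ : Dir 3 => β) (fun _ => hβ)).twoPoint L M x y := by
  letI : MeasurableSpace Circle := borel Circle
  haveI : BorelSpace Circle := ⟨rfl⟩
  obtain ⟨β₁, hβ₁, H⟩ := villain_torus_pairExpect_cosDiff_ge (d := 3) le_rfl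
  refine ⟨β₁, 1 / (2 * 8 ^ 6), by positivity, ?_⟩
  intro L M _ _ β hβ hK
  have hL : 0 < L := Nat.pos_of_ne_zero (NeZero.ne L)
  -- arithmetic of the sub-box side `n = ⌊L/8⌋`
  set n : ℕ := L / 8 with hn
  have h1 : 8 * n ≤ L := Nat.mul_div_le L 8
  have h2 : L < 8 * n + 8 := by
    have := Nat.div_add_mod L 8
    have := Nat.mod_lt L (by norm_num : 0 < 8)
    omega
  have hL' : (0 : ℝ) < L := by exact_mod_cast hL
  have h1' : 8 * (n : ℝ) ≤ L := by exact_mod_cast h1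
  have h2' : (L : ℝ) ≤ 8 * ((n : ℝ) + 1) := by
    have : (L : ℝ) < 8 * n + 8 := by exact_mod_cast h2
    linarith
  have h48 : 48 * (n : ℝ) ^ 2 < (L : ℝ) ^ 2 := by nlinarith
  have hpow : (L : ℝ) ^ 6 ≤ 8 ^ 6 * ((n : ℝ) + 1) ^ 6 := by
    calc (L : ℝ) ^ 6 ≤ (8 * ((n : ℝ) + 1)) ^ 6 := pow_le_pow_left₀ hL'.le h2' 6
      _ = 8 ^ 6 * ((n : ℝ) + 1) ^ 6 := by ring
  have h2n : 2 * n < L := by omega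
  -- the sub-box `{0,…,n}³` and its injective projection
  set C : Finset (Site 3) := Fintype.piFinset fun _ : Fin 3 => Finset.Icc (0 : ℤ) n with hC
  have hmemC : ∀ z ∈ C, ∀ i, 0 ≤ z i ∧ z i ≤ n := fun z hz i =>
    Finset.mem_Icc.1 ((Fintype.mem_piFinset.1 hz) i)
  have hcardC : C.card = (n + 1) ^ 3 := by
    rw [hC, Fintype.card_piFinset, Finset.prod_const, Finset.card_univ, Fintype.card_fin, Int.card_Icc,
      sub_zero, show ((n : ℤ) + 1) = ((n + 1 : ℕ) : ℤ) by push_cast; rfl, Int.toNat_natCast]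
  have hCbox : C ⊆ box 3 n := fun z hz => by
    rw [mem_box]
    intro i
    have := hmemC z hz i
    constructor <;> linarith [this.1, this.2]
  have hinjC : Set.InjOn (Torus.proj (d := 3) L) (C : Set (Site 3)) :=
    (torusProj_injOn_box_of_lt h2n).mono (Finset.coe_subset.2 hCbox)
  have hclose : ∀ x ∈ C, ∀ y ∈ C, 16 * ∑ i, ((x i : ℝ) - (y i : ℝ)) ^ 2 < (L : ℝ) ^ 2 := by
    intro x hx y hy
    have hterm : ∀ i, ((x i : ℝ) - (y i : ℝ)) ^ 2 ≤ (n : ℝ) ^ 2 := by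
      intro i
      have hxi := hmemC x hx i
      have hyi := hmemC y hy i
      have ha : ((x i : ℝ) - (y i : ℝ)) ≤ n := by
        have : x i - y i ≤ n := by linarith [hxi.2, hyi.1]
        exact_mod_cast this
      have hb : -(n : ℝ) ≤ ((x i : ℝ) - (y i : ℝ)) := by
        have : -(n : ℤ) ≤ x i - y i := by linarith [hxi.1, hyi.2]
        exact_mod_cast this
      nlinarith [abs_le.2 ⟨hb, ha⟩, sq_abs ((x i : ℝ) - (y i : ℝ))]
    have hsum : ∑ i, ((x i : ℝ) - (y i : ℝ)) ^ 2 ≤ 3 * (n : ℝ) ^ 2 := by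
      calc ∑ i, ((x i : ℝ) - (y i : ℝ)) ^ 2 ≤ ∑ _i : Fin 3, (n : ℝ) ^ 2 := Finset.sum_le_sum fun i _ => hterm i
        _ = 3 * (n : ℝ) ^ 2 := by simp
    linarith
  -- the two-point function on projected pairs is at least `1/2`
  set P := villain (fun _ : Dir 3 => β) (fun _ => hβ) with hP
  have hhalf : ∀ x ∈ C, ∀ y ∈ C, (1 / 2 : ℝ) ≤ P.twoPoint L M (Torus.proj L x) (Torus.proj L y) := by
    intro x hx y hy
    rw [hP, ← JCurrent.pairExpect_cosDiff_villain_eq_twoPoint (M := M) hβ]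
    exact H β hK L M x y (hclose x hx y hy)
  have hnonneg : ∀ p : TorusSite 3 L × TorusSite 3 L, 0 ≤ P.twoPoint L M p.1 p.2 :=
    fun p => P.twoPoint_nonneg L M p.1 p.2
  -- restrict the double sum to the projected sub-box
  set e : Site 3 × Site 3 → TorusSite 3 L × TorusSite 3 L := fun q => (Torus.proj L q.1, Torus.proj L q.2) with he
  have heinj : ∀ q ∈ C ×ˢ C, ∀ q' ∈ C ×ˢ C, e q = e q' → q = q' := by
    rintro ⟨a, b⟩ hab ⟨a', b'⟩ hab' h
    rw [Finset.mem_product] at hab hab'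
    simp only [he, Prod.mk.injEq] at h
    exact Prod.ext (hinjC (Finset.mem_coe.2 hab.1) (Finset.mem_coe.2 hab'.1) h.1)
      (hinjC (Finset.mem_coe.2 hab.2) (Finset.mem_coe.2 hab'.2) h.2)
  have s1 : 1 / (2 * 8 ^ 6) * (L : ℝ) ^ 6 ≤ ((C ×ˢ C).card : ℝ) * (1 / 2) := by
    rw [Finset.card_product, hcardC]
    push_cast
    nlinarith [hpow]
  have s2 : ((C ×ˢ C).card : ℝ) * (1 / 2) = ∑ _q ∈ C ×ˢ C, (1 / 2 : ℝ) := by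
    rw [Finset.sum_const, nsmul_eq_mul]
  have s3 : ∑ _q ∈ C ×ˢ C, (1 / 2 : ℝ) ≤ ∑ q ∈ C ×ˢ C, P.twoPoint L M (e q).1 (e q).2 := by
    refine Finset.sum_le_sum fun q hq => ?_
    rw [Finset.mem_product] at hq
    exact hhalf q.1 hq.1 q.2 hq.2
  have s4 : ∑ q ∈ C ×ˢ C, P.twoPoint L M (e q).1 (e q).2 =
      ∑ p ∈ (C ×ˢ C).image e, P.twoPoint L M p.1 p.2 :=
    (Finset.sum_image (f := fun p : TorusSite 3 L × TorusSite 3 L => P.twoPoint L M p.1 p.2) heinj).symm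
  have s5 : ∑ p ∈ (C ×ˢ C).image e, P.twoPoint L M p.1 p.2 ≤
      ∑ p : TorusSite 3 L × TorusSite 3 L, P.twoPoint L M p.1 p.2 :=
    Finset.sum_le_sum_of_subset_of_nonneg (Finset.subset_univ _) fun p _ _ => hnonneg p
  have s6 : ∑ p : TorusSite 3 L × TorusSite 3 L, P.twoPoint L M p.1 p.2 =
      ∑ x : TorusSite 3 L, ∑ y : TorusSite 3 L, P.twoPoint L M x y := Fintype.sum_prod_type _
  linarith [s1, s2, s3, s4, s5, s6]

end Literature.Probability.LatticeModels
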